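import Summits.AtomisticToContinuum.BoseEinsteinCondensation.Theorems.KineticLatticeBEC.Negative.CasimirCeiling
import Summits.AtomisticToContinuum.BoseEinsteinCondensation.Theorems.InsertionFieldDelocalisation.Negative.PerronExistence

/-!
# Negative lemmas for crux `KineticLatticeBEC` (stmt-AtomisticToContinuum-9671), V: sector selection and
Tóth's ceiling `rhs(L,N) ≤ N(L³ − N + 1)`

Supports (does not close) stmt-AtomisticToContinuum-9671. `H_pen(L,N)` is block diagonal in the down-spin
number with diagonal `4L³(L³ − N − #↓σ)²`, so `E₀ ≤ 0` and, by the master inequality, every ground vector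
is supported in the sector `n_up = N` (`apply_eq_zero_of_mem_groundSpace`; the `d = 3` case of the support
item `PenaltySelectsSector` in vector form — not that item's statement). In the sector the Casimir chain
gives Tóth1991's bound `rhs_le_toth : rhs(L,N) ≤ N(L³ − N + 1)`. Companion `HoleCap.lean`: every fixed-hole
cap `N + K ≤ L³` is refuted, prover-facing helpers, `rhs(L,0) = 0`.
-/

noncomputable section

namespace Summit.AtomisticToContinuum.BoseEinsteinCondensation.Theorems.KineticLatticeBEC.Negative

open scoped BigOperators ComplexOrder
open Literature.MathematicalPhysics.QuantumLattice Literature.Probability.LatticeModels Matrix Finset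
open Summit.AtomisticToContinuum.BoseEinsteinCondensation.Theses.BECStronglyRayleigh
open Summit.AtomisticToContinuum.BoseEinsteinCondensation.Theorems.LatticeODLROOffHalfFilling.Negative

/-! ### §5 SECTOR SELECTION (the cheap half of `PenaltySelectsSector`, from (★)), Tóth's ceiling
`rhs(L,N) ≤ N(L³ − N + 1)`, and every FIXED-hole cap `N ≤ L³ − K` is refuted

`H_pen(L,N)` is block diagonal in the down-spin number (`Hpen_apply_eq_zero_of_downCount_ne`, via the
landed `xxzZero_apply_eq_zero_of_weight_ne`), its diagonal is `4L³(L³ − N − #↓σ)²`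
(`Hpen_apply_self`, so `E₀ ≤ 0` by an in-sector basis vector), and by (★) the off-sector block is
`≥ L³`: hence every ground vector is supported in the sector `n_up = N` (`apply_eq_zero_of_mem_groundSpace`,
`L ≥ 3`, `N ≤ L³`). In the sector the Casimir chain of §3 gives Tóth1991's bound
`rhs_le_toth : rhs(L,N) ≤ N(L³ − N + 1)` (`N₀ ≤ N(L³−N+1)/L³`), and with §4:
`rhs(L, L³ − K) ≤ K(L³−K+1) + L³ − 2K ≤ (K+1)L³`, so `kineticLatticeBEC_false_withHoleCap K` — uniform
BEC with the cap `N + K ≤ L³` is FALSE for every fixed `K` (`K = 0` is §2). -/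

section Sector

open Summit.AtomisticToContinuum.BoseEinsteinCondensation.Theorems.InsertionFieldDelocalisation.Negative
  (xxzZero_apply xxzZero_apply_eq_zero_of_weight_ne)

variable {Λ : Type*} [Fintype Λ] [DecidableEq Λ]

omit [DecidableEq Λ] in
/-- The Lieb–Mattis weight `Σ_x σ_x` of a spin-½ configuration is its down-spin number. [folklore] -/
theorem weight_eq_downCount (σ : TensorIndex Λ 2) : (∑ x, (σ x : ℕ)) = downCount σ := by
  rw [downCount, Finset.card_eq_sum_ones, Finset.sum_filter]
  refine Finset.sum_congr rfl fun x _ => ?_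
  rcases Fin.exists_fin_two.mp ⟨σ x, rfl⟩ with h | h <;> simp [h]

omit [DecidableEq Λ] in
/-- `#↓σ ≤ |Λ|`. [folklore] -/
theorem downCount_le_card (σ : TensorIndex Λ 2) : downCount σ ≤ Fintype.card Λ := by
  rw [downCount]
  exact (Finset.card_filter_le _ _).trans (Finset.card_univ (α := Λ)).le

/-- The Casimir chain of §3, termwise: `Re⟨v, O v⟩ ≤ Σ_τ (#↓τ(|Λ| − #↓τ) + |Λ|/2)|v_τ|²`. [folklore] -/
theorem re_quad_obsO_le_sum (v : TensorIndex Λ 2 → ℂ) :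
    (star v ⬝ᵥ (obsO Λ) *ᵥ v).re ≤
      ∑ τ, ((downCount τ : ℝ) * (Fintype.card Λ - downCount τ) + Fintype.card Λ / 2) * ‖v τ‖ ^ 2 := by
  set V : ℝ := (Fintype.card Λ : ℝ) with hV
  rw [quad_obsO, Complex.add_re, re_star_dotProduct_self, re_quad_totalSpin_two]
  have hB := normSq_sumE_mulVec_sum_le v
  calc (∑ σ, ‖((∑ x : Λ, E x) *ᵥ v) σ‖ ^ 2) + ∑ σ, (V / 2 - downCount σ) * ‖v σ‖ ^ 2
      ≤ ∑ τ, (downCount τ : ℝ) * (V - downCount τ + 1) * ‖v τ‖ ^ 2 +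
          ∑ σ, (V / 2 - downCount σ) * ‖v σ‖ ^ 2 := by linarith
    _ = ∑ τ, ((downCount τ : ℝ) * (V - downCount τ) + V / 2) * ‖v τ‖ ^ 2 := by
        rw [← Finset.sum_add_distrib]
        refine Finset.sum_congr rfl fun τ _ => ?_
        ring

/-- **In-sector Casimir (Tóth) ceiling**: a vector supported on `#↓ = k₀` has
`Re⟨v, O v⟩ ≤ (k₀(|Λ| − k₀) + |Λ|/2)‖v‖²`. [folklore] -/
theorem re_quad_obsO_le_of_support (k₀ : ℕ) (v : TensorIndex Λ 2 → ℂ)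
    (hv : ∀ τ, downCount τ ≠ k₀ → v τ = 0) :
    (star v ⬝ᵥ (obsO Λ) *ᵥ v).re ≤
      ((k₀ : ℝ) * (Fintype.card Λ - k₀) + Fintype.card Λ / 2) * (star v ⬝ᵥ v).re := by
  refine (re_quad_obsO_le_sum v).trans ?_
  rw [re_star_dotProduct_self, Finset.mul_sum]
  refine Finset.sum_le_sum fun τ _ => ?_
  by_cases hτ : downCount τ = k₀
  · rw [hτ]
  · rw [hv τ hτ, norm_zero]
    simp

variable (L : ℕ) [NeZero L]

/-- **`H_pen` is block diagonal in the down-spin number.** [folklore] -/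
theorem Hpen_apply_eq_zero_of_downCount_ne (N : ℕ) {σ τ : TensorIndex (TorusSite 3 L) 2}
    (h : downCount σ ≠ downCount τ) : Hpen L N σ τ = 0 := by
  have hστ : σ ≠ τ := fun hst => h (by rw [hst])
  have h1 : xyTorus 3 L 1 σ τ = 0 :=
    xxzZero_apply_eq_zero_of_weight_ne _ _ (by rwa [weight_eq_downCount, weight_eq_downCount])
  have h2 : (pen L N ^ 2) σ τ = 0 := by
    have := congrFun (mulVec_single_one (pen L N ^ 2) τ) σ
    rw [Matrix.col_apply] at this
    rw [← this, pow_two, ← mulVec_mulVec, pen_mulVec_apply, pen_mulVec_apply, Pi.single_apply,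
      if_neg hστ, mul_zero, mul_zero]
  rw [Hpen_eq, Matrix.add_apply, Matrix.smul_apply, h1, h2, smul_zero, add_zero]

/-- **Diagonal of `H_pen`**: `(H_pen)_{σσ} = 4L³(L³ − N − #↓σ)²` (the XY part has zero diagonal).
[folklore] -/
theorem Hpen_apply_self (N : ℕ) (σ : TensorIndex (TorusSite 3 L) 2) :
    Hpen L N σ σ = (((3 + 1) * L ^ 3 : ℕ) : ℂ) * ((L : ℂ) ^ 3 - N - downCount σ) ^ 2 := by
  have h1 : xyTorus 3 L 1 σ σ = 0 := by
    rw [xyTorus, xxzZero_apply, if_pos rfl]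
  have h2 : (pen L N ^ 2) σ σ = ((L : ℂ) ^ 3 - N - downCount σ) ^ 2 := by
    have := congrFun (mulVec_single_one (pen L N ^ 2) σ) σ
    rw [Matrix.col_apply] at this
    rw [← this, pow_two, ← mulVec_mulVec, pen_mulVec_apply, pen_mulVec_apply, Pi.single_apply,
      if_pos rfl, mul_one, pow_two]
  rw [Hpen_eq, Matrix.add_apply, Matrix.smul_apply, h1, h2, smul_eq_mul, zero_add]

/-- **`E₀(H_pen(L,N)) ≤ 0` for `N ≤ L³`** (trial state: any basis configuration with `N` up spins).
[folklore] -/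
theorem groundEnergy_Hpen_nonpos {N : ℕ} (hN : N ≤ L ^ 3) : (Hpen L N).groundEnergy ≤ 0 := by
  obtain ⟨T, -, hT⟩ := Finset.exists_subset_card_eq (s := (Finset.univ : Finset (TorusSite 3 L)))
    (n := L ^ 3 - N) (by rw [Finset.card_univ, card_site]; omega)
  set ρ : TensorIndex (TorusSite 3 L) 2 := fun x => if x ∈ T then 1 else 0 with hρ
  have hρT : (Finset.univ.filter fun x : TorusSite 3 L => ρ x = 1) = T := by
    ext x
    by_cases hx : x ∈ T <;> simp [hρ, hx]
  have hρd : downCount ρ = L ^ 3 - N := by rw [downCount, hρT, hT]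
  set e : TensorIndex (TorusSite 3 L) 2 → ℂ := Pi.single ρ 1 with he
  have hstar : star e = e := by
    ext τ
    rw [he, Pi.star_apply, Pi.single_apply]
    split_ifs <;> simp
  have hnorm : star e ⬝ᵥ e = 1 := by
    rw [hstar, he, single_dotProduct, one_mul, Pi.single_eq_same]
  have h := groundEnergy_le_rayleigh_holds (Hpen_isHermitian L N) e hnorm
  rw [hstar, he, mulVec_single_one, single_dotProduct, one_mul, Matrix.col_apply, Hpen_apply_self,
    hρd, Nat.cast_sub hN, Nat.cast_pow] at h
  have hz : ((((3 + 1) * L ^ 3 : ℕ) : ℂ) * ((L : ℂ) ^ 3 - N - ((L : ℂ) ^ 3 - N)) ^ 2).re = 0 := by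
    simp
  rwa [hz] at h

/-- **SECTOR SELECTION.** For `L ≥ 3` and `N ≤ L³`, every ground vector of `H_pen(L,N)` is supported
in the sector `n_up = N` (`#↓ = L³ − N`): the off-sector block of `H_pen` is `≥ L³ > 0 ≥ E₀` by (★),
and `H_pen` does not mix the blocks. (The `d = 3` case of the support item `PenaltySelectsSector` in
vector form; not that item's statement.) [folklore] -/
theorem apply_eq_zero_of_mem_groundSpace (hL : 3 ≤ L) {N : ℕ} (hN : N ≤ L ^ 3)
    {v : TensorIndex (TorusSite 3 L) 2 → ℂ} (hv : v ∈ (Hpen L N).groundSpace)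
    {σ : TensorIndex (TorusSite 3 L) 2} (hσ : downCount σ ≠ L ^ 3 - N) : v σ = 0 := by
  set W : ℕ := L ^ 3 - N with hW
  set w : TensorIndex (TorusSite 3 L) 2 → ℂ := fun τ => if downCount τ = W then 0 else v τ with hw
  set u : TensorIndex (TorusSite 3 L) 2 → ℂ := fun τ => if downCount τ = W then v τ else 0 with hu
  have hvu : v = w + u := by
    ext τ
    simp only [hw, hu, Pi.add_apply]
    split_ifs <;> simp
  have hHu : ∀ τ, downCount τ ≠ W → (Hpen L N *ᵥ u) τ = 0 := by
    intro τ hτ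
    rw [mulVec, dotProduct]
    refine Finset.sum_eq_zero fun ρ _ => ?_
    by_cases hρ : downCount ρ = W
    · rw [Hpen_apply_eq_zero_of_downCount_ne L N (by rw [hρ]; exact hτ), zero_mul]
    · simp [hu, hρ]
  have hwHu : star w ⬝ᵥ (Hpen L N *ᵥ u) = 0 := by
    rw [dotProduct]
    refine Finset.sum_eq_zero fun τ _ => ?_
    by_cases hτ : downCount τ = W
    · simp [hw, hτ]
    · rw [hHu τ hτ, mul_zero]
  have hwv : star w ⬝ᵥ v = star w ⬝ᵥ w := by
    rw [dotProduct, dotProduct]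
    refine Finset.sum_congr rfl fun τ _ => ?_
    by_cases hτ : downCount τ = W <;> simp [hw, hτ]
  rw [mem_groundSpace_iff] at hv
  have hq : (star w ⬝ᵥ (Hpen L N) *ᵥ w).re = (Hpen L N).groundEnergy * (star w ⬝ᵥ w).re := by
    have h1 : star w ⬝ᵥ (Hpen L N) *ᵥ v = star w ⬝ᵥ (Hpen L N) *ᵥ w := by
      rw [hvu, mulVec_add, dotProduct_add, hwHu, add_zero]
    rw [← h1, hv, dotProduct_smul, hwv, smul_eq_mul, Complex.re_ofReal_mul]
  have hE0 := groundEnergy_Hpen_nonpos L hN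
  have hww : 0 ≤ (star w ⬝ᵥ w).re := (Complex.nonneg_iff.mp (dotProduct_star_self_nonneg _)).1
  have hquad : (star w ⬝ᵥ (Hpen L N) *ᵥ w).re ≤ 0 := by
    rw [hq]
    exact mul_nonpos_of_nonpos_of_nonneg hE0 hww
  have hM := re_quad_Hpen_ge L hL N w
  have hcard : ((L ^ 3 : ℕ) : ℝ) = (L : ℝ) ^ 3 := by push_cast; ring
  have hterm : ∀ τ : TensorIndex (TorusSite 3 L) 2, (L : ℝ) ^ 3 * ‖w τ‖ ^ 2 ≤
      (4 * (L : ℝ) ^ 3 * ((L : ℝ) ^ 3 - N - downCount τ) ^ 2 - 3 * downCount τ) * ‖w τ‖ ^ 2 := by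
    intro τ
    by_cases hτ : downCount τ = W
    · have : w τ = 0 := by simp [hw, hτ]
      rw [this, norm_zero]
      simp
    · apply mul_le_mul_of_nonneg_right _ (sq_nonneg _)
      have hk : (downCount τ : ℝ) ≤ (L : ℝ) ^ 3 := by
        rw [← hcard, ← card_site L]
        exact_mod_cast downCount_le_card τ
      have hsq : (1 : ℝ) ≤ ((L : ℝ) ^ 3 - N - downCount τ) ^ 2 := by
        have hWr : ((W : ℕ) : ℝ) = (L : ℝ) ^ 3 - N := by rw [hW, Nat.cast_sub hN, hcard]
        rw [← hWr]
        rcases lt_or_gt_of_ne hτ with hlt | hgt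
        · have : (downCount τ : ℝ) + 1 ≤ W := by exact_mod_cast hlt
          nlinarith
        · have : (W : ℝ) + 1 ≤ downCount τ := by exact_mod_cast hgt
          nlinarith
      have hL0 : (0 : ℝ) ≤ (L : ℝ) ^ 3 := by positivity
      nlinarith
  have hsum : (L : ℝ) ^ 3 * ∑ τ, ‖w τ‖ ^ 2 ≤ 0 := by
    rw [Finset.mul_sum]
    exact (Finset.sum_le_sum fun τ _ => hterm τ).trans (hM.trans hquad)
  have hL3 : (0 : ℝ) < (L : ℝ) ^ 3 := by
    have : (3 : ℝ) ≤ L := by exact_mod_cast hL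
    positivity
  have hS0 : ∑ τ, ‖w τ‖ ^ 2 ≤ 0 := by
    by_contra hcon
    push Not at hcon
    nlinarith
  have hnn : ∀ τ ∈ (Finset.univ : Finset (TensorIndex (TorusSite 3 L) 2)), 0 ≤ ‖w τ‖ ^ 2 :=
    fun τ _ => sq_nonneg _
  have hzero := (Finset.sum_eq_zero_iff_of_nonneg hnn).mp (le_antisymm hS0 (Finset.sum_nonneg hnn))
  have hwσ : w σ = v σ := by simp [hw, hσ]
  have h0 := hzero σ (Finset.mem_univ σ)
  rw [hwσ] at h0
  exact norm_eq_zero.mp (sq_eq_zero_iff.mp h0)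

/-- **Tóth's in-sector ceiling for the tracial ground state**: `Re ω(O) ≤ N(L³ − N) + L³/2`
(`L ≥ 3`, `N ≤ L³`). [folklore] -/
theorem re_gsf_obsO_le_sector (hL : 3 ≤ L) {N : ℕ} (hN : N ≤ L ^ 3) :
    ((Hpen L N).groundStateFunctional (obsO (TorusSite 3 L))).re ≤
      (N : ℝ) * ((L : ℝ) ^ 3 - N) + (L : ℝ) ^ 3 / 2 := by
  set B : ℝ := (N : ℝ) * ((L : ℝ) ^ 3 - N) + (L : ℝ) ^ 3 / 2 with hB
  have hT : ∀ v ∈ (Hpen L N).groundSpace,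
      0 ≤ (star v ⬝ᵥ (((B : ℝ) : ℂ) • (1 : Op (TorusSite 3 L) 2) - obsO (TorusSite 3 L)) *ᵥ v).re := by
    intro v hv
    have h := re_quad_obsO_le_of_support (L ^ 3 - N) v
      (fun τ hτ => apply_eq_zero_of_mem_groundSpace L hL hN hv hτ)
    rw [card_site, Nat.cast_sub hN] at h
    push_cast at h
    rw [sub_mulVec, dotProduct_sub, Complex.sub_re, smul_mulVec, one_mulVec, dotProduct_smul,
      smul_eq_mul, Complex.re_ofReal_mul]
    have hB' : ((L : ℝ) ^ 3 - N) * ((L : ℝ) ^ 3 - ((L : ℝ) ^ 3 - N)) + (L : ℝ) ^ 3 / 2 = B := by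
      rw [hB]; ring
    rw [hB'] at h
    linarith
  have h := re_gsf_nonneg_of_groundSpace hT
  rw [map_sub, map_smul, groundStateFunctional_one (Hpen_isHermitian L _), Complex.sub_re,
    smul_eq_mul, mul_one, Complex.ofReal_re] at h
  linarith

/-- **TÓTH'S BOUND** `rhs(L,N) ≤ N(L³ − N + 1)` (Tóth1991: `λ_max(γ_N) ≤ N(|Λ| − N + 1)/|Λ|` for
hard-core lattice bosons), here for the tracial ground state of the penalised Hamiltonian
(`L ≥ 3`, `N ≤ L³`). At `N = 1` it is attained by the uniform one-particle ground state
(`rhs(L,1) = L³`, i.e. `N₀ = 1`; ED job j013112 confirms `N₀/N = 1.00000` at `N = 1`). [folklore] -/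
theorem rhs_le_toth (hL : 3 ≤ L) {N : ℕ} (hN : N ≤ L ^ 3) :
    rhs L N ≤ (N : ℝ) * ((L : ℝ) ^ 3 - N + 1) := by
  rw [rhs]
  have := re_gsf_obsO_le_sector L hL hN
  linarith

end Sector

end Summit.AtomisticToContinuum.BoseEinsteinCondensation.Theorems.KineticLatticeBEC.Negative
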